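import Literature.MathematicalPhysics.QuantumFieldTheory.Balaban1983to89.B8Thm2TorusMemberCatalogue
import Literature.MathematicalPhysics.QuantumFieldTheory.Balaban1983to89.B9SectDSup

/-!
# `Balaban1983to89.B8Thm2TorusKnitParamsExist` — M5.9 ASSEMBLY, FILE A12: THE SCALAR SIDE CONDITIONS OF FILES A8–A11 ARE JOINTLY SATISFIABLE — print's
# «for M sufficiently large» ([Balaban1985BackgroundPropagators] Thm 3.7 p.410, Thm 3.9 p.413, (3.95)–(3.96) p.411; [Balaban1984PropagatorsII] Lemma 2.1
# (2.61)–(2.67) p.234) AS AN EXPLICIT CHOICE OF THE FORTY SCALARS `KnitCubeParams` with `p.Valid` ∧ `KnitCubeGeoValid` ∧ `c_L·L² < α₀′`, GIVEN the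
# `M`-independent amplitudes ∕ rates ∕ counts of the analytic cube data and thresholds on its four `M`-dependent constants `θ` (3.89), `ℓ₀, ℓ₁` (slow
# variation of `h_□`), `D_sep` (separation); and the endpoint of file A11 re-issued with the scalars chosen

T. Bałaban, *Propagators for lattice gauge theories in a background field*, Commun. Math. Phys. **99** (1985) 389–434 [Balaban1985BackgroundPropagators] («[B9]»),
THM 3.7 p. 410 («for M sufficiently large … θ ≦ ½»), (3.95)–(3.96) p. 411, THM 3.9 p. 413; T. Bałaban, *Propagators and renormalization transformations
for lattice gauge theories. II*, Commun. Math. Phys. **96** (1984) 223–250 [Balaban1984PropagatorsII] («[4]»), LEMMA 2.1 (2.61)–(2.63) p. 234 and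
(2.64)–(2.67) p. 234 («O(M⁻¹)c₁ ≦ ½»); T. Bałaban, *Averaging operations for lattice gauge theories*, Commun. Math. Phys. **98** (1985) 17–51
[Balaban1985Averaging], Prop. 1 ∕ Prop. 2 p. 26 (the constants `C₀`, `c₂′`); consumed for T. Bałaban, *Spaces of regular gauge field configurations on a
lattice and gauge fixing conditions*, Commun. Math. Phys. **99** (1985) 75–102 [Balaban1985RegularSpaces] («[B8]»), THM 2 p. 83.

Sub-row G-B8-T2S «[B8] §3 Thm 2 TORUS SUPPLIER» (unit `lit-balaban-t2s-1`, gen 5), QUESTION (iv) of gen 4's closing list («numeric windows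
satisfiability»).  Files A8–A11 (`B8Thm2TorusKnitMajorantsOfCubes`, `B8Thm2SetupTorusOfCubes`, `B8Thm2TorusKnitCubeGeometry`, `B8Thm2TorusMemberCatalogue`)
reduced [B8] Thm 2 at the `SU(N)`-valued Setup-torus objects to the analytic cube data `KnitCubeAnalytic … p …`, the (B)-lines, and ≈ 70 SCALAR side
conditions on the record `p : KnitCubeParams` — `p.Valid d ℓ b M₂` (46 fields: signs, the three located smallness conditions `N′θc₁(α₁) < 1`,
`θ₂c₁(α₂) < 1`, `(θ₁+θ₂+θ₃)c₁(ρδ₀, α′) < 1`, the couplings `AG ≤ A`, `δ_G ≤ rG`, the exponent splits, the final-rate budget, the [Balaban1985Averaging]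
thresholds `C₀α₀′ ≤ ⅓`, `2α₀′ ≤ c₂′`), `KnitCubeGeoValid d ℓ hd hL b₀ b₁ p dρ` (24 fields: positivity of the seven rate pairs, the (2.61) door exponents,
`C_G ≥ L²`, `C ≥ L⁴`) and `c_L·L² < p.α₀′`.  THIS FILE PROVES THEY ARE JOINTLY SATISFIABLE, in the order of quantifiers the analytic side needs:

* §1 arithmetic of the thresholds, each in a small context: `e^{−x} ≤ 1∕(1+x)`, the separation form `Q∕(τc) ≤ D ⟹ Q·e^{−cD} ≤ τ` (`mul_exp_neg_le`),
  `(1 − x)⁻¹ ≤ 2` for `x ≤ ½` (reused from `B9SectDSup`), a monotone triple product, and the six located inequalities as stand-alone lemmas (`smallG₁_aux`: `N′θc₁ ≤ ½` at `θ ≤ θ_*`;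
  `A₁_aux`: `0 ≤ A₁ ≤ A₁*`; `θtr_aux`: `θ₂c₁ ≤ ¼` at `α₀′ ≤ 1∕(4T)`; `AG_aux`: `AG ≤ 2A₁*c₁`; `θ₃_aux`; `small_aux`: `(θ₁+θ₂+θ₃)c₁ < 1` at `θᵢ ≤ τ`;
  `C0_aux`; `window_aux`).
* §2 ★★★ **`exists_valid`** — GIVEN a real basis `b` of `M_N(ℂ)` with `M₂`-bounded coordinates and the `M`-INDEPENDENT constants of the analytic data
  (M5.5: the Cor.-3.6 constant `B_G0 ≥ 0`, base rate `δ_G0 > 0`, overlap counts `N_G, N′_G ≥ 0`, left-entry constant `A_E ≥ 0`; M5.6: the cube letters'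
  amplitude `A_c ≥ 0` and rate `δ_c > 0`, the per-cube (3.48) constant `B_C ≥ 0` and rate `δ_C > 0`, overlap count `N ≥ 0`, the [2]-difference constant
  `κ_D ≥ 0`), THERE ARE thresholds `θ_* , ℓ_* > 0`, `D_*`, a radius `c_L > 0` and targets `A ≥ A_c`, `0 < δ_G ≤ δ_c`, `0 < δ₀ ≤ δ_C` (all depending on the
  given constants, `d`, `L`, `b`, `M₂` and the family's (2.61) door exponents only) such that EVERY `0 ≤ θ ≤ θ_*`, `0 ≤ ℓ₀, ℓ₁ ≤ ℓ_*`, `D_sep ≥ D_*` — the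
  four `M`-dependent constants, print's «M sufficiently large» — admit `p : KnitCubeParams` and `dρ` with `p.Valid d ℓ b M₂ ∧ KnitCubeGeoValid … p dρ ∧
  c_L·L² < p.α₀′` and the prescribed fields (`p.BG₀ = B_G0`, …, `p.θG = θ`, `p.A = A`, `p.δG = δ_G`, `p.B₀ = B_C`, `p.δ₀ = δ₀`, `p.bb = p.aD = 1`, `p.Dsep =
  D_sep`, `p.ℓ₀ = ℓ₀`, `p.ℓ₁ = ℓ₁`).  The choice: exponents `α₁ = α₂ = α_G = α₂′ = α′ = ½`, `ρ = α_st = a_sep = α_c = ¼`, `a_L = a_D = b = 1`,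
  `β_x = 1`; rates `δ_G = min(δ_G0∕4, δ_c)`, `δ₀ = min(δ_G∕4, δ_C)`, `δ = δ₀∕8`, `ρ_f = δ₀∕16`, `ε₀ = δ₀∕32`; dimensions = the door exponents `exp261`
  of the family at the seven rate pairs; `C_G = L²`, `C = L⁴`; `α₀′ = min(1∕(3C₀), c₂′∕2, 1∕(4T))` with `T = 32(d+1)²(M₂Σ‖b_j‖+1)(A₁*+1)(c₁+1)`,
  `A₁* = 2N_G B_G0 c₁(½)`; `c_L = α₀′∕(2L²)`; `A = max(2A₁*c₁, A_c)`; `θ_* = 1∕(2(N′_G+1)(c₁+1))`; `τ = 1∕(4(c₁(ρδ₀,α′)+1))` and `D_*`, `ℓ_*` making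
  each of `θ₁, θ₂, θ₃ ≤ τ`.
* §3 ★★★★★★★ **`thm2SetupSUAt_catalogued_exists_of_constants`** — file A11's endpoint `thm2SetupSUAt_catalogued_exists` with the scalar side conditions
  DISCHARGED by §2: from the `M`-independent constants alone, thresholds and targets as above, and for every admissible `(θ, ℓ₀, ℓ₁, D_sep)` a record `p`
  (prescribed fields) with the catalogue `k₀, mem, ιBm`, constants `B₁, B₂, c₁ > 0`, and the two displayed arrows (analytic cube data `KnitCubeAnalytic …
  p …` per member and background; (B)-lines) → `Thm2SetupSUAt (PV d ℓ m K hd hL) N k η 0 B₁ B₂ c₁ len (fun _ => True)`.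

HONEST SCOPE.  Real arithmetic only (explicit choices, `min`∕`max`, `e^{−x} ≤ 1∕(1+x)`); NO estimate of [4] ∕ [B8] ∕ [B9] is proved; the analytic cube data
(M5.5's Thm-3.7 data at `parSymY`, M5.6's Thm-3.9 per-cube data at `parKnitY` incl. the local inverse property and the [2]-difference majorants = GAP
G-B9-05) and the (B)-lines `B9P3PerAt` stay DISPLAYED antecedents, inhabited by nothing here; the located volume threshold `k + k₀ ≤ m + K` and `L ≥ 5`
of file A11 stand; count-neutral; N05 ∕ `stub_PV3A` NOT discharged; nothing continuum ∕ ℝ⁴ ∕ OS ∕ mass-gap ∕ Clay — the Yang–Mills mass gap is NOT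
proved.  No `sorry`, no `axiom`, no `def`, no `… : Prop` fact, no `instance`, no `notation`.  NEW file; nothing landed is modified.  Seat `lit-balaban-t2s-1`
gen 5, 2026-08-28.
-/

noncomputable section

open scoped BigOperators

namespace Literature.MathematicalPhysics.QuantumFieldTheory.Balaban1983to89.B8Thm2TorusKnitParamsExist

open Node00 B6KLevelCensusIndexV1 B9Eq39Adjoint
open B7Prop1Explicit renaming Site → LSite
open B7Prop1Explicit (e)
open B7Prop2Explicit (C0 c2' C0_pos c2'_pos)
open B6RandomWalk (c1_nonneg)
open B9SectDSup (inv_one_sub_le_two)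
open B9GeoNormsKLevelV1 (geo9K)
open B9RWSums347DefiniteFaces (exp261)
open B6GlobalChartV1 (PV)
open B6Ineq2142KLevelV1 (β)
open B8Ineq132 (InAk)
open B8Thm2TorusLettersPerOfKnit (bgY)
open B8Thm2TorusKnitEstimatesOfMajorants (B9P3PerAt)
open B8Thm2TorusKnitMajorantsOfCubes (KnitCubeParams)
open B8Thm2TorusKnitCubeGeometry (KnitCubeGeoValid KnitCubeAnalytic)
open B8Thm2TorusMemberCatalogue (thm2SetupSUAt_catalogued_exists)
open B7Prop2SpecialUnitary (specialUnitaryUnits)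
open B8Thm2SetupTorus (Thm2SetupSUAt)
open scoped Matrix Matrix.Norms.L2Operator

variable {d ℓ : ℕ} {hd : 1 ≤ d + 1} {hL : Odd (ℓ + 1) ∧ 1 < ℓ + 1} {b₀ b₁ : ℝ}

/-! ## §1 Arithmetic of the thresholds -/

section Arith

/-- `e^{−x} ≤ 1∕(1+x)` for `x ≥ 0` (from `1 + x ≤ eˣ`). [folklore] -/
private theorem exp_neg_le_one_div {x : ℝ} (hx : 0 ≤ x) : Real.exp (-x) ≤ 1 / (1 + x) := by
  rw [Real.exp_neg, ← one_div]
  exact one_div_le_one_div_of_le (by linarith) (by linarith [Real.add_one_le_exp x])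

/-- **The separation threshold**: `Q ≥ 0`, `c, τ > 0`, `Q∕(τc) ≤ D` ⟹ `Q·e^{−cD} ≤ τ` — the form in which «M sufficiently large» makes the `e^{−δ₀D_sep}`-small
constants `θ₁, θ₂` of [Balaban1985BackgroundPropagators] (3.95)–(3.96) small. [cite: Balaban1985BackgroundPropagators, (3.95)–(3.96) p.411, bookkeeping] -/
theorem mul_exp_neg_le {Q c τ D : ℝ} (hQ : 0 ≤ Q) (hc : 0 < c) (hτ : 0 < τ) (hD : Q / (τ * c) ≤ D) :
    Q * Real.exp (-(c * D)) ≤ τ := by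
  have hQD : Q ≤ D * (τ * c) := by rwa [div_le_iff₀ (mul_pos hτ hc)] at hD
  have hD0 : 0 ≤ D := le_trans (div_nonneg hQ (mul_pos hτ hc).le) hD
  have hcD : 0 ≤ c * D := mul_nonneg hc.le hD0
  have h1 : Q * Real.exp (-(c * D)) ≤ Q * (1 / (1 + c * D)) :=
    mul_le_mul_of_nonneg_left (exp_neg_le_one_div hcD) hQ
  have h2 : Q ≤ τ * (1 + c * D) := by nlinarith [hQD, hτ]
  calc Q * Real.exp (-(c * D)) ≤ Q * (1 / (1 + c * D)) := h1
    _ = Q / (1 + c * D) := by rw [mul_one_div]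
    _ ≤ τ := by rw [div_le_iff₀ (by linarith)]; exact h2

/-- monotone triple product of nonnegative reals. [folklore] -/
private theorem mul3_le {a b c a' b' c' : ℝ} (ha : 0 ≤ a) (hb : 0 ≤ b) (hc : 0 ≤ c) (ha' : a ≤ a') (hb' : b ≤ b') (hc' : c ≤ c') :
    a * b * c ≤ a' * b' * c' :=
  mul_le_mul (mul_le_mul ha' hb' hb (ha.trans ha')) hc' hc (mul_nonneg (ha.trans ha') (hb.trans hb'))

/-- M5.5's located smallness at the threshold `θ_* = 1∕(2(N′+1)(c₁+1))`: `N′θc₁ ≤ ½`. [cite: Balaban1985BackgroundPropagators, Thm 3.7 p.410 («θ ≦ ½»), bookkeeping] -/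
theorem smallG₁_aux {N' θ c θs : ℝ} (hN' : 0 ≤ N') (hθ0 : 0 ≤ θ) (hθ : θ ≤ θs) (hc : 0 ≤ c)
    (hθs : θs = 1 / (2 * (N' + 1) * (c + 1))) : N' * θ * c ≤ 1 / 2 := by
  have h1 : N' * θ * c ≤ (N' + 1) * θs * (c + 1) := mul3_le hN' hθ0 hc (by linarith) hθ (by linarith)
  have h2 : (N' + 1) * θs * (c + 1) = 1 / 2 := by
    rw [hθs]; field_simp
  linarith

/-- the located amplitude `A₁ = N B₀c₁(1 − N′θc₁)⁻¹` is between `0` and `A₁* = 2N B₀c₁` once `N′θc₁ ≤ ½`. [cite: Balaban1985BackgroundPropagators, (3.90) p.410, bookkeeping] -/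
theorem A₁_aux {N B c x : ℝ} (hN : 0 ≤ N) (hB : 0 ≤ B) (hc : 0 ≤ c) (hx : x ≤ 1 / 2) :
    0 ≤ N * B * c * (1 - x)⁻¹ ∧ N * B * c * (1 - x)⁻¹ ≤ 2 * (N * B * c) := by
  refine ⟨mul_nonneg (by positivity) (inv_nonneg.2 (by linarith)), ?_⟩
  calc N * B * c * (1 - x)⁻¹ ≤ N * B * c * 2 := mul_le_mul_of_nonneg_left (inv_one_sub_le_two hx) (by positivity)
    _ = 2 * (N * B * c) := by ring

/-- the transfer's located smallness at the flatness `α₀′ ≤ 1∕(4T)`, `T = D(S+1)(A₁*+1)(c₁+1)`: `θ₂c₁ = Dα₀′SA₁c₁ ≤ ¼`. [cite: Balaban1984PropagatorsII, (2.66)–(2.67) p.234, bookkeeping] -/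
theorem θtr_aux {D α S A₁ As c T : ℝ} (hD : 0 ≤ D) (hα0 : 0 ≤ α) (hS : 0 ≤ S) (hA₁0 : 0 ≤ A₁) (hA₁ : A₁ ≤ As) (hc : 0 ≤ c)
    (hT : T = D * (S + 1) * (As + 1) * (c + 1)) (hT0 : 0 < T) (hα : α ≤ 1 / (4 * T)) :
    D * α * S * A₁ * c ≤ 1 / 4 := by
  have h1 : S * A₁ * c ≤ (S + 1) * (As + 1) * (c + 1) := mul3_le hS hA₁0 hc (by linarith) (by linarith) (by linarith)
  have h2 : D * α * S * A₁ * c = α * (D * (S * A₁ * c)) := by ring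
  have h3 : α * (D * (S * A₁ * c)) ≤ α * T := by
    refine mul_le_mul_of_nonneg_left ?_ hα0
    calc D * (S * A₁ * c) ≤ D * ((S + 1) * (As + 1) * (c + 1)) := mul_le_mul_of_nonneg_left h1 hD
      _ = T := by rw [hT]; ring
  have h4 : α * T ≤ 1 / (4 * T) * T := mul_le_mul_of_nonneg_right hα hT0.le
  have h5 : 1 / (4 * T) * T = 1 / 4 := by field_simp
  linarith

/-- the coupling `AG = A₁c₁(1 − θ₂c₁)⁻¹ ≤ 2A₁*c₁` once `θ₂c₁ ≤ ½`. [cite: Balaban1985BackgroundPropagators, Thm 3.1 (3.42) p.397, bookkeeping] -/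
theorem AG_aux {A₁ As c y : ℝ} (hA₁0 : 0 ≤ A₁) (hA₁ : A₁ ≤ As) (hc : 0 ≤ c) (hy : y ≤ 1 / 2) :
    A₁ * c * (1 - y)⁻¹ ≤ As * c * 2 :=
  mul_le_mul (mul_le_mul_of_nonneg_right hA₁ hc) (inv_one_sub_le_two hy) (inv_nonneg.2 (by linarith))
    (mul_nonneg (hA₁0.trans hA₁) hc)

/-- the slow-variation threshold: `ℓ₀, ℓ₁ ≤ ℓ_*` with `ℓ_*(1+i)(Q+1) = τ` ⟹ `(ℓ₀ + ℓ₁i)Q ≤ τ` (the constant `θ₃` of (3.95)–(3.96)).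
[cite: Balaban1985BackgroundPropagators, (3.95)–(3.96) p.411, bookkeeping] -/
theorem θ₃_aux {l₀ l₁ ls i Q τ : ℝ} (hl₀ : l₀ ≤ ls) (hl₁ : l₁ ≤ ls) (hi : 0 ≤ i) (hQ : 0 ≤ Q) (hls : 0 ≤ ls)
    (hτ : ls * ((1 + i) * (Q + 1)) = τ) : (l₀ + l₁ * i) * Q ≤ τ := by
  have h1 : l₀ + l₁ * i ≤ ls * (1 + i) := by
    have := mul_le_mul_of_nonneg_right hl₁ hi
    linarith
  calc (l₀ + l₁ * i) * Q ≤ ls * (1 + i) * Q := mul_le_mul_of_nonneg_right h1 hQ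
    _ ≤ ls * (1 + i) * (Q + 1) := mul_le_mul_of_nonneg_left (by linarith) (by positivity)
    _ = τ := by rw [← hτ]; ring

/-- file A7's located smallness at `τ = 1∕(4(c₁+1))`: `θ₁, θ₂, θ₃ ≤ τ` ⟹ `(θ₁+θ₂+θ₃)c₁ < 1`. [cite: Balaban1985BackgroundPropagators, Thm 3.9 p.413, bookkeeping] -/
theorem small_aux {t₁ t₂ t₃ τ c : ℝ} (h₁ : t₁ ≤ τ) (h₂ : t₂ ≤ τ) (h₃ : t₃ ≤ τ) (hc : 0 ≤ c) (hτ : τ = 1 / (4 * (c + 1))) :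
    (t₁ + t₂ + t₃) * c < 1 := by
  have h1 : (t₁ + t₂ + t₃) * c ≤ 3 * τ * c := mul_le_mul_of_nonneg_right (by linarith) hc
  have h2 : 3 * τ * c < 1 := by
    rw [hτ, show 3 * (1 / (4 * (c + 1))) * c = 3 * c / (4 * (c + 1)) by ring, div_lt_one (by positivity)]
    linarith
  linarith

/-- the [Balaban1985Averaging] threshold `C₀α₀′ ≤ ⅓` at `α₀′ ≤ 1∕(3C₀)`. [cite: Balaban1985Averaging, Prop. 2 p.26, bookkeeping] -/
theorem C0_aux {C α : ℝ} (hC : 0 < C) (h : α ≤ 1 / (3 * C)) : C * α ≤ 1 / 3 :=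
  calc C * α ≤ C * (1 / (3 * C)) := mul_le_mul_of_nonneg_left h hC.le
    _ = 1 / 3 := by field_simp

/-- the window `c_L·L² < α₀′` at `c_L = α₀′∕(2L²)`. [cite: Balaban1985RegularSpaces, (1.32) p.82, bookkeeping] -/
theorem window_aux {α L2 : ℝ} (hα : 0 < α) (hL2 : 0 < L2) : α / (2 * L2) * L2 < α := by
  rw [div_mul_eq_mul_div, div_lt_iff₀ (by positivity)]
  nlinarith

end Arith

/-! ## §2 ★★★ The scalar side conditions are jointly satisfiable -/

section Exist

variable [instF : ∀ i : KIdx d ℓ hd hL b₀ b₁, Fintype (geo9K i).Site]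
set_option maxHeartbeats 400000 in
/-- ★★★ **THE SCALARS OF FILES A8–A11 EXIST** («for M sufficiently large»).  Given a real basis `b` of `M_N(ℂ)` with `M₂`-bounded coordinates and the
`M`-independent constants of the analytic cube data — M5.5: `B_G0 ≥ 0` (Cor. 3.6 constant of the cube terms), `δ_G0 > 0` (base rate), `N_G, N′_G ≥ 0`
(overlap counts), `A_E ≥ 0` (left entries); M5.6: the cube letters' amplitude `A_c ≥ 0` and rate `δ_c > 0`, the per-cube (3.48) constant `B_C ≥ 0` and rate
`δ_C > 0`, the overlap count `N ≥ 0`, the [2]-difference constant `κ_D ≥ 0` — there are thresholds `θ_*, ℓ_* > 0`, `D_*`, a radius `c_L > 0` and targets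
`A ≥ A_c`, `0 < δ_G ≤ δ_c`, `0 < δ₀ ≤ δ_C` such that every `0 ≤ θ ≤ θ_*` ((3.89)), `0 ≤ ℓ₀, ℓ₁ ≤ ℓ_*` (slow variation), `D_sep ≥ D_*` (separation) admit
`p : KnitCubeParams`, `dρ` with `p.Valid d ℓ b M₂`, `KnitCubeGeoValid d ℓ hd hL b₀ b₁ p dρ`, `c_L·L² < p.α₀′` and the prescribed fields.  Real arithmetic;
no estimate of the papers is proved.
[cite: Balaban1985BackgroundPropagators, Thm 3.7 p.410 («for M sufficiently large»), (3.95)–(3.96) p.411, Thm 3.9 p.413; Balaban1984PropagatorsII, Lemma 2.1 (2.61)–(2.63) p.234, (2.66)–(2.67) p.234; Balaban1985Averaging, Prop. 1–2 p.26] -/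
theorem exists_valid {N : ℕ} {ι : Type} [Fintype ι] (b : Module.Basis ι ℝ (Matrix (Fin N) (Fin N) ℂ)) {M₂ : ℝ} (hM₂ : 0 ≤ M₂)
    (hrepr : ∀ (v : Matrix (Fin N) (Fin N) ℂ) (j : ι), |b.repr v j| ≤ M₂ * ‖v‖)
    {BG₀ δG₀ NG NG' AE Ac δc BC δC Nn κD : ℝ} (hBG₀ : 0 ≤ BG₀) (hδG₀ : 0 < δG₀) (hNG : 0 ≤ NG) (hNG' : 0 ≤ NG')
    (hAE : 0 ≤ AE) (hAc : 0 ≤ Ac) (hδc : 0 < δc) (hBC : 0 ≤ BC) (hδC : 0 < δC) (hNn : 0 ≤ Nn) (hκD : 0 ≤ κD) :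
    ∃ θs ℓs Ds cL A δG δ₀ : ℝ, 0 < θs ∧ 0 < ℓs ∧ 0 < cL ∧ Ac ≤ A ∧ 0 < δG ∧ δG ≤ δc ∧ 0 < δ₀ ∧ δ₀ ≤ δC ∧
      ∀ θG ℓ₀ ℓ₁ Dsep : ℝ, 0 ≤ θG → θG ≤ θs → 0 ≤ ℓ₀ → ℓ₀ ≤ ℓs → 0 ≤ ℓ₁ → ℓ₁ ≤ ℓs → Ds ≤ Dsep →
        ∃ (p : KnitCubeParams) (dρ : ℕ), p.Valid d ℓ b M₂ ∧ KnitCubeGeoValid d ℓ hd hL b₀ b₁ p dρ ∧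
          cL * (((ℓ + 1 : ℕ) : ℝ)) ^ (2 * 1) < p.α₀' ∧
          p.BG₀ = BG₀ ∧ p.δG₀ = δG₀ ∧ p.NG = NG ∧ p.NG' = NG' ∧ p.AE = AE ∧ p.θG = θG ∧ p.A = A ∧ p.δG = δG ∧
          p.B₀ = BC ∧ p.δ₀ = δ₀ ∧ p.bb = 1 ∧ p.aD = 1 ∧ p.Nn = Nn ∧ p.κD = κD ∧ p.Dsep = Dsep ∧ p.ℓ₀ = ℓ₀ ∧ p.ℓ₁ = ℓ₁ := by
  have hLpos : (0 : ℝ) < (ℓ : ℝ) + 1 := by positivity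
  have hL2 : (0 : ℝ) < (((ℓ + 1 : ℕ) : ℝ)) ^ (2 * 1) := by positivity
  have hD0 : (0 : ℝ) ≤ 32 * ((d : ℝ) + 1) ^ 2 := by positivity
  -- (1) the door exponents and Lemma-2.1 constants of M5.5 (`α₁ = ½`) and of the transfer (`α₂ = ½`)
  obtain ⟨dG₁, hdG₁⟩ : ∃ n : ℕ, n = exp261 (geo9K (d := d) (ℓ := ℓ) (hd := hd) (hL := hL) (b₀ := b₀) (b₁ := b₁)) δG₀ (1 / 2) := ⟨_, rfl⟩
  obtain ⟨dG₂, hdG₂⟩ : ∃ n : ℕ, n = exp261 (geo9K (d := d) (ℓ := ℓ) (hd := hd) (hL := hL) (b₀ := b₀) (b₁ := b₁))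
    ((1 - 1 / 2) * δG₀) (1 / 2) := ⟨_, rfl⟩
  set c1a : ℝ := B6.c1 dG₁ δG₀ (1 / 2) with hc1a
  set c1b : ℝ := B6.c1 dG₂ ((1 - 1 / 2) * δG₀) (1 / 2) with hc1b
  have hc1a0 : 0 ≤ c1a := c1_nonneg _ _ _
  have hc1b0 : 0 ≤ c1b := c1_nonneg _ _ _
  -- (2) the (3.89) threshold `θ_*` and the bound `A₁* = 2N_G B_G0 c₁` of the located amplitude `A₁`
  obtain ⟨θs, hθs⟩ : ∃ x : ℝ, x = 1 / (2 * (NG' + 1) * (c1a + 1)) := ⟨_, rfl⟩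
  have hθs0 : 0 < θs := by rw [hθs]; positivity
  obtain ⟨A1s, hA1s⟩ : ∃ x : ℝ, x = 2 * (NG * BG₀ * c1a) := ⟨_, rfl⟩
  have hA1s0 : 0 ≤ A1s := by rw [hA1s]; positivity
  -- (3) the flatness `α₀′` and the radius `c_L`
  set Sb : ℝ := M₂ * ∑ j, ‖b j‖ with hSb
  have hSb0 : 0 ≤ Sb := mul_nonneg hM₂ (Finset.sum_nonneg fun j _ => norm_nonneg _)
  obtain ⟨Tt, hTt⟩ : ∃ x : ℝ, x = 32 * ((d : ℝ) + 1) ^ 2 * (Sb + 1) * (A1s + 1) * (c1b + 1) := ⟨_, rfl⟩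
  have hTt0 : 0 < Tt := by rw [hTt]; positivity
  have hC0 := C0_pos (d + 1)
  have hc2 := c2'_pos (d + 1) (ℓ + 1) (by omega)
  obtain ⟨αs, hαs⟩ : ∃ x : ℝ, x = min (min (1 / (3 * C0 (d + 1))) (c2' (d + 1) (ℓ + 1) / 2)) (1 / (4 * Tt)) := ⟨_, rfl⟩
  have hαs0 : 0 < αs := by rw [hαs]; exact lt_min (lt_min (by positivity) (by positivity)) (by positivity)
  have hαs1 : αs ≤ 1 / (3 * C0 (d + 1)) := by rw [hαs]; exact (min_le_left _ _).trans (min_le_left _ _)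
  have hαs2 : αs ≤ c2' (d + 1) (ℓ + 1) / 2 := by rw [hαs]; exact (min_le_left _ _).trans (min_le_right _ _)
  have hαs3 : αs ≤ 1 / (4 * Tt) := by rw [hαs]; exact min_le_right _ _
  obtain ⟨cL, hcL⟩ : ∃ x : ℝ, x = αs / (2 * (((ℓ + 1 : ℕ) : ℝ)) ^ (2 * 1)) := ⟨_, rfl⟩
  have hcL0 : 0 < cL := by rw [hcL]; positivity
  have hwin : cL * (((ℓ + 1 : ℕ) : ℝ)) ^ (2 * 1) < αs := by rw [hcL]; exact window_aux hαs0 hL2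
  -- (4) file A7's common rate `δ_G` and amplitude `A`, and `κ_G`
  obtain ⟨δG, hδG⟩ : ∃ x : ℝ, x = min (δG₀ / 4) δc := ⟨_, rfl⟩
  have hδG0 : 0 < δG := by rw [hδG]; exact lt_min (by positivity) hδc
  have hδG1 : δG ≤ δG₀ / 4 := by rw [hδG]; exact min_le_left _ _
  have hδG2 : δG ≤ δc := by rw [hδG]; exact min_le_right _ _
  obtain ⟨d₂, hd₂⟩ : ∃ n : ℕ, n = exp261 (geo9K (d := d) (ℓ := ℓ) (hd := hd) (hL := hL) (b₀ := b₀) (b₁ := b₁))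
    ((1 - 1 / 2) * δG) (1 / 2) := ⟨_, rfl⟩
  set c1w : ℝ := B6.c1 d₂ ((1 - 1 / 2) * δG) (1 / 2) with hc1w
  have hc1w0 : 0 ≤ c1w := c1_nonneg _ _ _
  obtain ⟨A, hA⟩ : ∃ x : ℝ, x = max (A1s * c1b * 2) Ac := ⟨_, rfl⟩
  have hAc' : Ac ≤ A := by rw [hA]; exact le_max_right _ _
  have hA0 : 0 ≤ A := hAc.trans hAc'
  have hA1 : A1s * c1b * 2 ≤ A := by rw [hA]; exact le_max_left _ _
  set κ : ℝ := A ^ 2 * ((ℓ : ℝ) + 1) ^ 2 * c1w with hκ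
  have hκ0 : 0 ≤ κ := by positivity
  -- (5) M5.6's base rate `δ₀`, the last door exponents and Lemma-2.1 constants, the located threshold `τ`
  obtain ⟨δ₀, hδ₀⟩ : ∃ x : ℝ, x = min (δG / 4) δC := ⟨_, rfl⟩
  have hδ₀0 : 0 < δ₀ := by rw [hδ₀]; exact lt_min (by positivity) hδC
  have hδ₀1 : δ₀ ≤ δG / 4 := by rw [hδ₀]; exact min_le_left _ _
  have hδ₀2 : δ₀ ≤ δC := by rw [hδ₀]; exact min_le_right _ _
  have hq0 : (0 : ℝ) < 1 / 4 * δ₀ := by positivity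
  have h2δ₀ : (0 : ℝ) < 2 * δ₀ := by positivity
  obtain ⟨d', hd'⟩ : ∃ n : ℕ, n = max (exp261 (geo9K (d := d) (ℓ := ℓ) (hd := hd) (hL := hL) (b₀ := b₀) (b₁ := b₁)) δ₀ (1 - 1 / 4))
    (exp261 (geo9K (d := d) (ℓ := ℓ) (hd := hd) (hL := hL) (b₀ := b₀) (b₁ := b₁)) (1 / 4 * δ₀) (1 / 2)) := ⟨_, rfl⟩
  obtain ⟨d₁, hd₁⟩ : ∃ n : ℕ, n = exp261 (geo9K (d := d) (ℓ := ℓ) (hd := hd) (hL := hL) (b₀ := b₀) (b₁ := b₁)) (δ₀ / 32) 1 :=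
    ⟨_, rfl⟩
  obtain ⟨dρ, hdρ⟩ : ∃ n : ℕ, n = exp261 (geo9K (d := d) (ℓ := ℓ) (hd := hd) (hL := hL) (b₀ := b₀) (b₁ := b₁)) (δ₀ / 16) 1 :=
    ⟨_, rfl⟩
  set c1c : ℝ := B6.c1 d' δ₀ (1 - 1 / 4) with hc1c
  set c1f : ℝ := B6.c1 d' (1 / 4 * δ₀) (1 / 2) with hc1f
  have hc1c0 : 0 ≤ c1c := c1_nonneg _ _ _
  have hc1f0 : 0 ≤ c1f := c1_nonneg _ _ _
  obtain ⟨τ, hτ⟩ : ∃ x : ℝ, x = 1 / (4 * (c1f + 1)) := ⟨_, rfl⟩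
  have hτ0 : 0 < τ := by rw [hτ]; positivity
  -- (6) the separation threshold `D_*` and the slow-variation threshold `ℓ_*`
  obtain ⟨Q₁, hQ₁⟩ : ∃ x : ℝ, x = Nn * (Sb ^ 2 * κ * BC * ((ℓ : ℝ) + 1) ^ 4 * c1c) := ⟨_, rfl⟩
  obtain ⟨Q₂, hQ₂⟩ : ∃ x : ℝ, x = Nn * (κD * BC * ((ℓ : ℝ) + 1) ^ 4 * c1c) := ⟨_, rfl⟩
  have hQ₁0 : 0 ≤ Q₁ := by rw [hQ₁]; positivity
  have hQ₂0 : 0 ≤ Q₂ := by rw [hQ₂]; positivity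
  obtain ⟨Ds, hDs⟩ : ∃ x : ℝ, x = Q₁ / (τ * (1 / 4 * δ₀)) + Q₂ / (τ * (2 * δ₀)) := ⟨_, rfl⟩
  have hDs1 : Q₁ / (τ * (1 / 4 * δ₀)) ≤ Ds := by
    rw [hDs]; exact le_add_of_nonneg_right (div_nonneg hQ₂0 (mul_pos hτ0 h2δ₀).le)
  have hDs2 : Q₂ / (τ * (2 * δ₀)) ≤ Ds := by
    rw [hDs]; exact le_add_of_nonneg_left (div_nonneg hQ₁0 (mul_pos hτ0 hq0).le)
  have hi0 : (0 : ℝ) ≤ (1 / 4 * δ₀)⁻¹ := inv_nonneg.2 hq0.le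
  have hX : (0 : ℝ) < (1 + (1 / 4 * δ₀)⁻¹) * (Q₁ + 1) := by positivity
  obtain ⟨ℓs, hℓs⟩ : ∃ x : ℝ, x = τ / ((1 + (1 / 4 * δ₀)⁻¹) * (Q₁ + 1)) := ⟨_, rfl⟩
  have hℓs0 : 0 < ℓs := by rw [hℓs]; positivity
  have hℓsτ : ℓs * ((1 + (1 / 4 * δ₀)⁻¹) * (Q₁ + 1)) = τ := by rw [hℓs]; exact div_mul_cancel₀ τ hX.ne'
  -- numeric facts used by the two records (proved before the record enters the context)
  have n1 : (0 : ℝ) ≤ (1 - 1 / 2) * δG₀ := by positivity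
  have n2 : (0 : ℝ) ≤ (1 - 1 / 2) * ((1 - 1 / 2) * δG₀) := by positivity
  have n3 : (0 : ℝ) ≤ 1 / 2 * ((1 - 1 / 2) * δG₀) := by positivity
  have n4 : δG ≤ (1 - 1 / 2) * ((1 - 1 / 2) * δG₀) := by linarith
  have n5 : (0 : ℝ) ≤ ((ℓ : ℝ) + 1) ^ 2 := by positivity
  have n6 : (0 : ℝ) ≤ 1 / 2 * δG := by positivity
  have n7 : (0 : ℝ) ≤ (1 - 1 / 2) * δG := by positivity
  have n8 : 1 * δ₀ ≤ (1 - 1 / 2) * ((1 - 1 / 2) * δG) := by linarith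
  have n9 : (0 : ℝ) ≤ ((ℓ : ℝ) + 1) ^ 4 := by positivity
  have n10 : (0 : ℝ) ≤ δ₀ / 32 := by positivity
  have n11 : (0 : ℝ) ≤ δ₀ / 16 := by positivity
  have n12 : δ₀ / 16 + 2 * (1 * (δ₀ / 32)) ≤ δ₀ / 8 := by linarith
  have n13 : δ₀ / 8 ≤ δG := by linarith
  have n14 : δ₀ / 8 ≤ (1 - 1 / 2) * (1 / 4 * δ₀) := by linarith
  have g1 : (0 : ℝ) < 1 / 2 * δG₀ := by positivity
  have g2 : (0 : ℝ) < 1 / 2 * ((1 - 1 / 2) * δG₀) := by positivity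
  have g3 : (0 : ℝ) < 1 / 2 * ((1 - 1 / 2) * δG) := by positivity
  have g4 : (0 : ℝ) < 1 / 2 * δG := by positivity
  have g5 : (0 : ℝ) < (1 - 1 / 4) * δ₀ := by positivity
  have g6 : (0 : ℝ) < 1 / 2 * (1 / 4 * δ₀) := by positivity
  have g7 : (0 : ℝ) < 1 * (δ₀ / 32) := by positivity
  have g8 : (0 : ℝ) < 1 * (δ₀ / 16) := by positivity
  have e1 : exp261 (geo9K (d := d) (ℓ := ℓ) (hd := hd) (hL := hL) (b₀ := b₀) (b₁ := b₁)) δ₀ (1 - 1 / 4) ≤ d' := by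
    rw [hd']; exact le_max_left _ _
  have e2 : exp261 (geo9K (d := d) (ℓ := ℓ) (hd := hd) (hL := hL) (b₀ := b₀) (b₁ := b₁)) (1 / 4 * δ₀) (1 / 2) ≤ d' := by
    rw [hd']; exact le_max_right _ _
  refine ⟨θs, ℓs, Ds, cL, A, δG, δ₀, hθs0, hℓs0, hcL0, hAc', hδG0, hδG2, hδ₀0, hδ₀2, ?_⟩
  intro θG ℓ₀ ℓ₁ Dsep hθG0 hθG hℓ₀0 hℓ₀ hℓ₁0 hℓ₁ hDsep
  -- THE RECORD
  set p : KnitCubeParams :=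
    { dG₁ := dG₁, dG₂ := dG₂, δG₀ := δG₀, αG₁ := 1 / 2, θG := θG, BG₀ := BG₀, NG := NG, NG' := NG', αG₂ := 1 / 2, AE := AE, α₀' := αs
      d' := d', d₂ := d₂, A := A, δG := δG, αG := 1 / 2, α₂ := 1 / 2, CG := ((ℓ : ℝ) + 1) ^ 2, δ₀ := δ₀, aL := 1, aD := 1, αc := 1 / 4
      αst := 1 / 4, asep := 1 / 4, ρ := 1 / 4, bb := 1, κD := κD, Dsep := Dsep, ℓ₀ := ℓ₀, ℓ₁ := ℓ₁, B₀ := BC, C := ((ℓ : ℝ) + 1) ^ 4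
      Nn := Nn, α' := 1 / 2, d₁ := d₁, ε₀ := δ₀ / 32, βx := 1, ρf := δ₀ / 16, δ := δ₀ / 8 }
  -- (a) M5.5's located smallness `N′θc₁(α₁) ≤ ½` and the bound `0 ≤ A₁ ≤ A₁*`
  have hx : NG' * θG * c1a ≤ 1 / 2 := smallG₁_aux hNG' hθG0 hθG hc1a0 hθs
  have hA₁G : p.A₁G = NG * BG₀ * c1a * (1 - NG' * θG * c1a)⁻¹ := rfl
  obtain ⟨hA₁G0, hA₁G1⟩ : 0 ≤ p.A₁G ∧ p.A₁G ≤ A1s := by rw [hA₁G, hA1s]; exact A₁_aux hNG hBG₀ hc1a0 hx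
  -- (b) the transfer's located smallness `θ₂c₁(α₂) ≤ ¼` and the coupling `AG ≤ A`
  have hθtr : p.θtr d b M₂ = 32 * ((d : ℝ) + 1) ^ 2 * αs * Sb * p.A₁G := rfl
  have hy : p.θtr d b M₂ * c1b ≤ 1 / 4 := by
    rw [hθtr]; exact θtr_aux hD0 hαs0.le hSb0 hA₁G0 hA₁G1 hc1b0 hTt hTt0 hαs3
  have hAG : p.AG d b M₂ ≤ A := by
    have h : p.AG d b M₂ = p.A₁G * c1b * (1 - p.θtr d b M₂ * c1b)⁻¹ := rfl
    rw [h]; exact (AG_aux hA₁G0 hA₁G1 hc1b0 (by linarith)).trans hA1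
  -- (c) file A7's located smallness `(θ₁ + θ₂ + θ₃)c₁(ρδ₀, α′) < 1`
  have hκG : p.κG = κ := rfl
  have hθ₁ : p.θ₁ b M₂ ≤ τ := by
    have h : p.θ₁ b M₂ = Q₁ * Real.exp (-(1 / 4 * δ₀ * Dsep)) := by
      show Nn * ((Sb ^ 2 * p.κG) * BC * ((ℓ : ℝ) + 1) ^ 4 * c1c * Real.exp (-(1 / 4 * δ₀ * Dsep))) = _
      rw [hκG, hQ₁]; ring
    rw [h]; exact mul_exp_neg_le hQ₁0 hq0 hτ0 (hDs1.trans hDsep)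
  have hθ₂ : p.θ₂ ≤ τ := by
    have h : p.θ₂ = Q₂ * Real.exp (-(2 * δ₀ * Dsep)) := by
      show Nn * (κD * Real.exp (-(2 * δ₀ * Dsep)) * BC * ((ℓ : ℝ) + 1) ^ 4 * c1c) = _
      rw [hQ₂]; ring
    rw [h]; exact mul_exp_neg_le hQ₂0 h2δ₀ hτ0 (hDs2.trans hDsep)
  have hθ₃ : p.θ₃ b M₂ ≤ τ := by
    have h : p.θ₃ b M₂ = (ℓ₀ + ℓ₁ * (1 / 4 * δ₀)⁻¹) * Q₁ := by
      show Nn * ((ℓ₀ + ℓ₁ * (1 / 4 * δ₀)⁻¹) * (Sb ^ 2 * p.κG) * BC * ((ℓ : ℝ) + 1) ^ 4 * c1c) = _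
      rw [hκG, hQ₁]; ring
    rw [h]; exact θ₃_aux hℓ₀ hℓ₁ hi0 hQ₁0 hℓs0.le hℓsτ
  have hsmall : (p.θ₁ b M₂ + p.θ₂ + p.θ₃ b M₂) * B6.c1 p.d' (p.ρ * p.δ₀) p.α' < 1 :=
    small_aux hθ₁ hθ₂ hθ₃ hc1f0 hτ
  -- (d) the record satisfies `Valid`
  have hV : p.Valid d ℓ b M₂ :=
    { hM₂ := hM₂
      hrepr := hrepr
      hα := hαs0
      hα3 := C0_aux hC0 hαs1
      hα2 := by show 2 * αs ≤ c2' (d + 1) (ℓ + 1); linarith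
      hBG₀ := hBG₀
      hθG := hθG0
      hNG := hNG
      hNG' := hNG'
      hAE := hAE
      hαδ₁ := n1
      hsmallG₁ := by show NG' * θG * c1a < 1; linarith
      hαδ₂ := n2
      hαδ₂' := n3
      hsmallG₂ := by show p.θtr d b M₂ * c1b < 1; linarith
      hAG := hAG
      hδGr := n4
      hA := hA0
      hCG := n5
      hαGδ := n6
      hα₂0 := by show (0 : ℝ) ≤ 1 / 2; norm_num
      hα₂1 := by show (1 / 2 : ℝ) ≤ 1; norm_num
      hδG := n7
      hrate := n8
      hκD := hκD
      hℓ₀ := hℓ₀0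
      hℓ₁ := hℓ₁0
      hB₀ := hBC
      hC0 := n9
      hN := hNn
      hδ₀ := hδ₀0.le
      hasep := by show (0 : ℝ) ≤ 1 / 4; norm_num
      hρ := by show (0 : ℝ) ≤ 1 / 4; norm_num
      hρb := by show (1 / 4 : ℝ) ≤ 1; norm_num
      hαc := hq0
      hα'1 := by show (1 / 2 : ℝ) ≤ 1; norm_num
      hsplit₁ := by show (1 / 4 : ℝ) + 1 / 4 + 1 / 4 ≤ 1; norm_num
      hsplit₂ := by show (1 / 4 : ℝ) + 1 / 4 ≤ 1; norm_num
      hsplit₃ := by show (1 / 4 : ℝ) + 1 / 4 + 1 / 4 ≤ 1; norm_num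
      hsmall := hsmall
      hε₀ := n10
      hβx := by show (0 : ℝ) ≤ 1; norm_num
      hρf := n11
      hr := n12
      hle_G := n13
      hle_C := n14 }
  -- (e) the record satisfies `KnitCubeGeoValid` (door exponents by construction)
  have hG : KnitCubeGeoValid d ℓ hd hL b₀ b₁ p dρ :=
    { hG₁ := g1
      hδG₀ := hδG₀.le
      hαG₁ := by show (1 / 2 : ℝ) ≤ 1; norm_num
      hG₂ := g2
      hαδ₁ := n1
      hαG₂ := by show (1 / 2 : ℝ) ≤ 1; norm_num
      hGw := g3
      hTG := g4
      hb := g5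
      hfin := g6
      hρδ₀ := hq0.le
      hα' := by show (1 / 2 : ℝ) ≤ 1; norm_num
      hT4 := hq0
      hf := g7
      hρf := g8
      hdG₁ := le_of_eq hdG₁.symm
      hdG₂ := le_of_eq hdG₂.symm
      hd₂ := le_of_eq hd₂.symm
      hd'b := e1
      hd'f := e2
      hd₁ := le_of_eq hd₁.symm
      hdρ := le_of_eq hdρ.symm
      hCG := le_rfl
      hC := le_rfl }
  exact ⟨p, dρ, hV, hG, hwin, rfl, rfl, rfl, rfl, rfl, rfl, rfl, rfl, rfl, rfl, rfl, rfl, rfl, rfl, rfl, rfl, rfl⟩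

end Exist

/-! ## §3 ★★★★★★★ File A11's endpoint with the scalars chosen -/

section Endpoint

variable {N : ℕ} [NeZero N]
variable [instF : ∀ i : KIdx d ℓ hd hL b₀ b₁, Fintype (geo9K i).Site] [∀ i : KIdx d ℓ hd hL b₀ b₁, DecidableEq (geo9K i).Site]

/-- ★★★★★★★ **[B8] THM 2 AT THE `SU(N)`-VALUED SETUP-TORUS OBJECTS OF EVERY `PV d ℓ m K` WITH `k + k₀ ≤ m + K`, FROM THE ANALYTIC CUBE DATA AND THE (B)-LINES,
THE SCALAR SIDE CONDITIONS DISCHARGED** (`1 ≤ N ≤ 25`, `d + 1 ≥ 2`, odd `L = ℓ + 1 ≥ 5`, band `0 < b₀ ≤ b₁`; (B)-line constants `B₀ ≥ 2∕(5(d+1)L)`, `c_B9 > 0`;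
a real basis `b` of `M_N(ℂ)` with `M₂`-bounded coordinates; the `M`-independent constants of the analytic data as in `exists_valid`): THERE ARE thresholds
`θ_*, ℓ_* > 0`, `D_*`, a radius `c_L > 0` and targets `A ≥ A_c`, `0 < δ_G ≤ δ_c`, `0 < δ₀ ≤ δ_C` such that for EVERY admissible `(θ, ℓ₀, ℓ₁, D_sep)` («M
sufficiently large») there is a record `p : KnitCubeParams` with the prescribed fields, a catalogue `k₀, mem, ιBm` (spec of file A11) and `B₁, B₂, c₁ > 0` with:
for every `m K k η`, `1 ≤ k`, `k + k₀ ≤ m + K`, `η > 0` — analytic cube data `KnitCubeAnalytic (mem P₀ n) (bgY … U₀) b (ιBm P₀ n) Rr Hp p η_S⁻⁴` at every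
`n ≤ k` and every `SU(N)`-valued `P₀`-periodic `U₀ ∈ 𝔄_n(T_η, α₀)`, `α₀ ≤ c_L` → (B)-lines `B9P3PerAt` → `Thm2SetupSUAt (PV d ℓ m K hd hL) N k η 0 B₁ B₂ c₁
len (fun _ => True)`.  File A11's `thm2SetupSUAt_catalogued_exists` at the record of `exists_valid`; the two arrows' antecedents stay displayed, inhabited by
nothing here; located volume threshold `k + k₀ ≤ m + K`; no estimate of [B8]∕[B9] proved; `stub_PV3A` NOT discharged; the Yang–Mills mass gap is NOT proved.
[cite: Balaban1985RegularSpaces, Thm 2 p.83 («there exists B₁»), (1.33)–(1.39) pp.82–83, p.77; Balaban1985BackgroundPropagators, Thm 3.7 p.410 («for M sufficiently large»), Thm 3.9 p.413; Balaban1984PropagatorsII, (2.1)–(2.4) p.224, Lemma 2.1 p.234] -/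
theorem thm2SetupSUAt_catalogued_exists_of_constants (hN : N ≤ 25) (hd2 : 2 ≤ d + 1) (hℓ : 4 ≤ ℓ) (hb₀ : 0 < b₀) (hb₁ : b₀ ≤ b₁)
    {B₀ B₀β cB9 βH : ℝ} {len : LSite (d + 1) → ℝ}
    (hB₀ : 0 < B₀) (hB : 2 ≤ 5 * ((d + 1 : ℕ) : ℝ) * ((ℓ + 1 : ℕ) : ℝ) * B₀) (hcB9 : 0 < cB9)
    {ι : Type} [Fintype ι] [DecidableEq ι] (b : Module.Basis ι ℝ (Matrix (Fin N) (Fin N) ℂ)) {M₂ : ℝ} (hM₂ : 0 ≤ M₂)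
    (hrepr : ∀ (v : Matrix (Fin N) (Fin N) ℂ) (j : ι), |b.repr v j| ≤ M₂ * ‖v‖)
    {BG₀ δG₀ NG NG' AE Ac δc BC δC Nn κD : ℝ} (hBG₀ : 0 ≤ BG₀) (hδG₀ : 0 < δG₀) (hNG : 0 ≤ NG) (hNG' : 0 ≤ NG')
    (hAE : 0 ≤ AE) (hAc : 0 ≤ Ac) (hδc : 0 < δc) (hBC : 0 ≤ BC) (hδC : 0 < δC) (hNn : 0 ≤ Nn) (hκD : 0 ≤ κD) (Rr : ℝ) (Hp : Prop) :
    letI : CStarAlgebra (Matrix (Fin N) (Fin N) ℂ) := {}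
    ∃ θs ℓs Ds cL A δG δ₀ : ℝ, 0 < θs ∧ 0 < ℓs ∧ 0 < cL ∧ Ac ≤ A ∧ 0 < δG ∧ δG ≤ δc ∧ 0 < δ₀ ∧ δ₀ ≤ δC ∧
      ∀ θG ℓ₀ ℓ₁ Dsep : ℝ, 0 ≤ θG → θG ≤ θs → 0 ≤ ℓ₀ → ℓ₀ ≤ ℓs → 0 ≤ ℓ₁ → ℓ₁ ≤ ℓs → Ds ≤ Dsep →
        ∃ p : KnitCubeParams,
          (p.BG₀ = BG₀ ∧ p.δG₀ = δG₀ ∧ p.NG = NG ∧ p.NG' = NG' ∧ p.AE = AE ∧ p.θG = θG ∧ p.A = A ∧ p.δG = δG ∧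
            p.B₀ = BC ∧ p.δ₀ = δ₀ ∧ p.bb = 1 ∧ p.aD = 1 ∧ p.Nn = Nn ∧ p.κD = κD ∧ p.Dsep = Dsep ∧ p.ℓ₀ = ℓ₀ ∧ p.ℓ₁ = ℓ₁) ∧
        ∃ (k₀ : ℕ) (mem : ℤ → ℕ → KIdx d ℓ hd hL b₀ b₁) (ιBm : ∀ P n, BlkY (mem P n) → IBondY (mem P n)) (B₁ B₂ c₁ : ℝ),
          0 < B₁ ∧ 0 < B₂ ∧ 0 < c₁ ∧
          (∀ (m K n : ℕ), 1 ≤ n → n + k₀ ≤ m + K →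
            (mem (((PV d ℓ m K hd hL).sitesPerDir 0 : ℕ) : ℤ) n).m = m + K ∧ (mem (((PV d ℓ m K hd hL).sitesPerDir 0 : ℕ) : ℤ) n).K = 0 ∧
            (mem (((PV d ℓ m K hd hL).sitesPerDir 0 : ℕ) : ℤ) n).k = n + 1 ∧
            (mem (((PV d ℓ m K hd hL).sitesPerDir 0 : ℕ) : ℤ) n).cf = (((ℓ + 1 : ℕ) : ℝ)) ^ (mem (((PV d ℓ m K hd hL).sitesPerDir 0 : ℕ) : ℤ) n).k ∧
            (∀ z : SiteY (mem (((PV d ℓ m K hd hL).sitesPerDir 0 : ℕ) : ℤ) n), levY (mem (((PV d ℓ m K hd hL).sitesPerDir 0 : ℕ) : ℤ) n) z = n) ∧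
            ∀ t, β (mem (((PV d ℓ m K hd hL).sitesPerDir 0 : ℕ) : ℤ) n).hN (mem (((PV d ℓ m K hd hL).sitesPerDir 0 : ℕ) : ℤ) n).D
              (mem (((PV d ℓ m K hd hL).sitesPerDir 0 : ℕ) : ℤ) n).hk (ιBm (((PV d ℓ m K hd hL).sitesPerDir 0 : ℕ) : ℤ) n t) = t) ∧
          ∀ (m K k : ℕ) (η : ℝ), 1 ≤ k → k + k₀ ≤ m + K → 0 < η →
            (∀ n, 1 ≤ n → n ≤ k → ∀ ⦃α₀ : ℝ⦄, 0 < α₀ → α₀ ≤ cL → ∀ U₀ : LSite (d + 1) → Fin (d + 1) → (Matrix (Fin N) (Fin N) ℂ)ˣ,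
                (∀ x κ, U₀ x κ ∈ specialUnitaryUnits (Fin N)) →
                (∀ (x : LSite (d + 1)) (μ : Fin (d + 1)), U₀ (x + (((PV d ℓ m K hd hL).sitesPerDir 0 : ℕ) : ℤ) • e μ) = U₀ x) →
                InAk (ℓ + 1) n η α₀ (fun _ => (Set.univ : Set (LSite (d + 1)))) U₀ →
                Nonempty (KnitCubeAnalytic (mem (((PV d ℓ m K hd hL).sitesPerDir 0 : ℕ) : ℤ) n)
                  (bgY (mem (((PV d ℓ m K hd hL).sitesPerDir 0 : ℕ) : ℤ) n) U₀) b (ιBm (((PV d ℓ m K hd hL).sitesPerDir 0 : ℕ) : ℤ) n) Rr Hp p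
                  ((etaS (mem (((PV d ℓ m K hd hL).sitesPerDir 0 : ℕ) : ℤ) n) ^ 2 * etaS (mem (((PV d ℓ m K hd hL).sitesPerDir 0 : ℕ) : ℤ) n) ^ 2)⁻¹))) →
            (∀ m', m' ≤ k → ∀ ⦃α₀ : ℝ⦄, 0 < α₀ → α₀ ≤ cL → ∀ U₀ : LSite (d + 1) → Fin (d + 1) → (Matrix (Fin N) (Fin N) ℂ)ˣ,
                (∀ x κ, U₀ x κ ∈ specialUnitaryUnits (Fin N)) →
                (∀ (x : LSite (d + 1)) (μ : Fin (d + 1)), U₀ (x + (((PV d ℓ m K hd hL).sitesPerDir 0 : ℕ) : ℤ) • e μ) = U₀ x) →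
                InAk (ℓ + 1) m' η α₀ (fun _ => (Set.univ : Set (LSite (d + 1)))) U₀ →
                B9P3PerAt (𝔸 := Matrix (Fin N) (Fin N) ℂ) (ℓ + 1) B₀ B₀β cB9 βH len η m' α₀ (((PV d ℓ m K hd hL).sitesPerDir 0 : ℕ) : ℤ) U₀) →
            Thm2SetupSUAt (PV d ℓ m K hd hL) N k η 0 B₁ B₂ c₁ len (fun _ => True) := by
  letI : CStarAlgebra (Matrix (Fin N) (Fin N) ℂ) := {}
  obtain ⟨θs, ℓs, Ds, cL, A, δG, δ₀, hθs, hℓs, hcL, hA, hδG, hδGc, hδ₀, hδ₀C, H⟩ :=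
    exists_valid (d := d) (ℓ := ℓ) (hd := hd) (hL := hL) (b₀ := b₀) (b₁ := b₁) b hM₂ hrepr hBG₀ hδG₀ hNG hNG' hAE hAc hδc hBC hδC hNn hκD
  refine ⟨θs, ℓs, Ds, cL, A, δG, δ₀, hθs, hℓs, hcL, hA, hδG, hδGc, hδ₀, hδ₀C, fun θG ℓ₀ ℓ₁ Dsep h1 h2 h3 h4 h5 h6 h7 => ?_⟩
  obtain ⟨p, dρ, hV, hGv, hwin, hspec⟩ := H θG ℓ₀ ℓ₁ Dsep h1 h2 h3 h4 h5 h6 h7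
  exact ⟨p, hspec, thm2SetupSUAt_catalogued_exists (len := len) (B₀β := B₀β) (βH := βH) hN hd2 hℓ hb₀ hb₁ hB₀ hB hcB9 hcL p hV hGv hwin Rr Hp⟩

end Endpoint

end Literature.MathematicalPhysics.QuantumFieldTheory.Balaban1983to89.B8Thm2TorusKnitParamsExist

end
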